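import Summits.ValiantsHypothesis.ValiantsHypothesis.Theorems.LacunarySymmetroidMatrixDescartesCensusMirror
import Summits.ValiantsHypothesis.ValiantsHypothesis.Theorems.LacunarySymmetroidMatrixDescartesCensusDoorA

/-!
# `MatrixDescartes` census — the MIRROR rays of the nine kernel-certified `(2,6)` families

HONEST FRAMING.  Object-search cell `pub-symmetroid`, route crux `Theses.LacunarySymmetroid.MatrixDescartes`
(ledger item stmt-ValiantsHypothesis-18050).  Bookkeeping only: the kernel column holds UNIFORM ray theorems
`Census.posRoots_le_19_on_2_6_<B>_N` («no real symmetric `2 × 2` pencil on the support `B ∪ {N}` has `20 = D(2,6)` distinct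
positive det-roots, for every `N ≥ N₁`»; files `…CensusTNCUnif*.lean`, `…CensusDoorA.lean`).  The cell's atlas and box
tables always list a support next to its MIRROR `N − d` (reversal `x ↦ x⁻¹`); by `Census.posRootLawOn_iff_mirror_rev`
(`…CensusMirror.lean`) each ray theorem yields the mirror ray verbatim.  This file records the mirror rays of the six families of `…CensusDoorA.lean` as
door-A table rows (the three engine-4 families `(0,2,6,11,14)`, `(0,7,12,15,16)`, `(0,1,3,8,12)` follow in a second file once their node modules are built) (`PosRootLawOn 2 6 19 d`, `…CensusDefs.lean`):

| base `B` (kernel ray, `N ≥ N₁`) | mirror ray certified here |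
|---|---|
| `(0,9,11,12,17)`, `35` | `(0, N−17, N−12, N−11, N−9, N)` |
| `(0,1,4,10,12)`, `25` | `(0, N−12, N−10, N−4, N−1, N)` |
| `(0,3,4,11,16)`, `33` | `(0, N−16, N−11, N−4, N−3, N)` |
| `(0,8,9,11,15)`, `31` | `(0, N−15, N−11, N−9, N−8, N)` |
| `(0,9,10,12,16)`, `33` | `(0, N−16, N−12, N−10, N−9, N)` |
| `(0,4,6,7,15)`, `31` | `(0, N−15, N−7, N−6, N−4, N)` |

Nothing here bears on `DoorA26` / `DoorA34` (OPEN, never asserted), on the V = 19 layer, on the crux `MatrixDescartes`, or on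
`VP ≠ VNP`.  [folklore] Reversal `x ↦ x⁻¹`; the certificates are the cited kernel theorems'.
-/

-- `Summit.ValiantsHypothesis.ValiantsHypothesis.…` repeats a component by the D-0017 layout
-- (single-conjunct summit), which the `dupNamespace` linter flags; the name is mandated.
set_option linter.dupNamespace false

namespace Summit.ValiantsHypothesis.ValiantsHypothesis.Theorems.LacunarySymmetroidMatrixDescartes.Census

open Polynomial Finset
open scoped BigOperators Polynomial Matrix
open Summit.ValiantsHypothesis.ValiantsHypothesis.Theorems.MatrixDescartes.Negative (PosRootLawAt)

/-- The mirror of a sorted `(2,6)` family support `(0, b₁, b₂, b₃, b₄, N)` (`b₄ ≤ N`) is `(0, N−b₄, N−b₃, N−b₂, N−b₁, N)`,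
and a door-A row transfers along it. [folklore] -/
theorem posRootLawOn_two_six_family_mirror {B : ℕ} (b₁ b₂ b₃ b₄ N : ℕ) (h₁ : b₁ ≤ N) (h₂ : b₂ ≤ N) (h₃ : b₃ ≤ N)
    (h₄ : b₄ ≤ N) (h : PosRootLawOn 2 6 B (![0, b₁, b₂, b₃, b₄, N] : Fin 6 → ℕ)) :
    PosRootLawOn 2 6 B (![0, N - b₄, N - b₃, N - b₂, N - b₁, N] : Fin 6 → ℕ) := by
  have hd : ∀ l, (![0, b₁, b₂, b₃, b₄, N] : Fin 6 → ℕ) l ≤ N := by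
    intro l; fin_cases l <;> simp <;> omega
  have hm := (posRootLawOn_iff_mirror_rev (m := 2) (B := B) _ N hd).1 h
  have e : (fun l : Fin 6 => N - (![0, b₁, b₂, b₃, b₄, N] : Fin 6 → ℕ) (Fin.rev l))
      = (![0, N - b₄, N - b₃, N - b₂, N - b₁, N] : Fin 6 → ℕ) := by
    funext l; fin_cases l <;> simp [Fin.rev]
  rw [e] at hm
  exact hm

/-- Mirror of the record family: `ζ(2,6; 0, N−17, N−12, N−11, N−9, N) ≤ 19` for every `N ≥ 35`. [folklore] -/
theorem doorA26_on_mirror_family_0_9_11_12_17 (N : ℕ) (hN : 35 ≤ N) :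
    PosRootLawOn 2 6 19 (![0, N - 17, N - 12, N - 11, N - 9, N] : Fin 6 → ℕ) :=
  posRootLawOn_two_six_family_mirror 9 11 12 17 N (by omega) (by omega) (by omega) (by omega)
    (doorA26_on_record_family N hN)

/-- Mirror of the family `(0,1,4,10,12,N)`: `ζ(2,6; 0, N−12, N−10, N−4, N−1, N) ≤ 19` for every `N ≥ 25`. [folklore] -/
theorem doorA26_on_mirror_family_0_1_4_10_12 (N : ℕ) (hN : 25 ≤ N) :
    PosRootLawOn 2 6 19 (![0, N - 12, N - 10, N - 4, N - 1, N] : Fin 6 → ℕ) :=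
  posRootLawOn_two_six_family_mirror 1 4 10 12 N (by omega) (by omega) (by omega) (by omega)
    (doorA26_on_family_0_1_4_10_12 N hN)

/-- Mirror of the family `(0,3,4,11,16,N)`: `ζ(2,6; 0, N−16, N−11, N−4, N−3, N) ≤ 19` for every `N ≥ 33`. [folklore] -/
theorem doorA26_on_mirror_family_0_3_4_11_16 (N : ℕ) (hN : 33 ≤ N) :
    PosRootLawOn 2 6 19 (![0, N - 16, N - 11, N - 4, N - 3, N] : Fin 6 → ℕ) :=
  posRootLawOn_two_six_family_mirror 3 4 11 16 N (by omega) (by omega) (by omega) (by omega)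
    (doorA26_on_family_0_3_4_11_16 N hN)

/-- Mirror of the family `(0,8,9,11,15,N)`: `ζ(2,6; 0, N−15, N−11, N−9, N−8, N) ≤ 19` for every `N ≥ 31`. [folklore] -/
theorem doorA26_on_mirror_family_0_8_9_11_15 (N : ℕ) (hN : 31 ≤ N) :
    PosRootLawOn 2 6 19 (![0, N - 15, N - 11, N - 9, N - 8, N] : Fin 6 → ℕ) :=
  posRootLawOn_two_six_family_mirror 8 9 11 15 N (by omega) (by omega) (by omega) (by omega)
    (doorA26_on_family_0_8_9_11_15 N hN)

/-- Mirror of the family `(0,9,10,12,16,N)`: `ζ(2,6; 0, N−16, N−12, N−10, N−9, N) ≤ 19` for every `N ≥ 33`. [folklore] -/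
theorem doorA26_on_mirror_family_0_9_10_12_16 (N : ℕ) (hN : 33 ≤ N) :
    PosRootLawOn 2 6 19 (![0, N - 16, N - 12, N - 10, N - 9, N] : Fin 6 → ℕ) :=
  posRootLawOn_two_six_family_mirror 9 10 12 16 N (by omega) (by omega) (by omega) (by omega)
    (doorA26_on_family_0_9_10_12_16 N hN)

/-- Mirror of the family `(0,4,6,7,15,N)`: `ζ(2,6; 0, N−15, N−7, N−6, N−4, N) ≤ 19` for every `N ≥ 31`. [folklore] -/
theorem doorA26_on_mirror_family_0_4_6_7_15 (N : ℕ) (hN : 31 ≤ N) :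
    PosRootLawOn 2 6 19 (![0, N - 15, N - 7, N - 6, N - 4, N] : Fin 6 → ℕ) :=
  posRootLawOn_two_six_family_mirror 4 6 7 15 N (by omega) (by omega) (by omega) (by omega)
    (doorA26_on_family_0_4_6_7_15 N hN)

end Summit.ValiantsHypothesis.ValiantsHypothesis.Theorems.LacunarySymmetroidMatrixDescartes.Census
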